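/-
Copyright (c) 2026 the pub-hodgecm-mathlib formalisation cell (harness21).  Prover seat hodgecm-mathlib-LA3-p01 (g2), «GO 500» half A line L3
(socket `stub_FROB`, road ROOF → `stub_ROOF0`, road of record (ρ-𝔟), LA3-plan (g0) RULINGS #5–#7), organ (ρ-𝔟-asm) «THE DOWNSTAIRS DUAL OF THE ROOF MIDDLE»; 2026-09-02.
-/
import Literature.AlgebraicGeometry.AbelianSchemes.IdealTorsionQuotientClassInvariance
import Literature.AlgebraicGeometry.AbelianSchemes.IdealTorsionQuotientTwistHom
import Literature.AlgebraicGeometry.AbelianSchemes.RoofMiddleTransportAlongIso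
import Literature.AlgebraicGeometry.AbelianSchemes.DualIsogenyConjCancel
import Literature.AlgebraicGeometry.AbelianSchemes.AbelianSchemeOverQuasiInverseIsogeny
import Literature.AlgebraicGeometry.AbelianSchemes.SerreTensorIsogeny
import Literature.Algebra.Module.DivisibleActionSurjective
import Literature.NumberTheory.NumberFields.ConjugateIdealScalar
import HarnessLib

/-!
# The dual of the roof middle from an ideal-torsion quotient: `∃ (DB̄, λ_B̄)` on the target of `c̄` with `c̄ ≫ λ_B̄ ≫ c̄^∨ = λ ≫ [p]`
# ([MumfordAV1970] §7 Thm. 4, §15 Thm. 1, §23; [MilneCM2006] §7; [Neukirch1999] I §3)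

Topic `AlgebraicGeometry/AbelianSchemes`, namespace `Literature.AlgebraicGeometry.AbelianSchemes.AbelianSchemeOver`.  THEOREMS ONLY (no definition, no named fact,
no `instance`, no notation, no `sorry`).  Cell `hodgecm-mathlib` (D-0151), F0∕P6 «MOD», «GO 500» line L3 (socket `stub_FROB` → `stub_ROOF0`), ROAD OF RECORD (ρ-𝔟) (LA3-plan
(g0) RULINGS #5–#7) — THE ASSEMBLY of its ★ organs into the one row the legs need: over an algebraically closed field, an abelian scheme `A` with an `𝓞_F`-action `ι`, a dual
pair `D` (unit pin) and a dual homomorphism `λ` with ROSATI rows `ι(c̄ b) ≫ λ = λ ≫ ι(b)^∨` (`c` an involution of `𝓞_F`), an fppf quotient `q_K : A → Q` with IDEAL-SHAPE kernel law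
`A[𝔟]` and a dual pair `D_Q` (unit pin) — ★ `QuotientDualPairKernelLawOfIdealClass` ∕ (U) —, a surjective homomorphism `c̄ : A → B̄` with kernel law `A[𝔭]`, the class equation
`𝔟 = x·𝔭` (`x ∈ F×`), and `𝔭·c(𝔭)·𝔡 = (p)`.  THEN **there are a dual pair `D_B̄` of `B̄` with its unit pin and a homomorphism `λ_B̄ : B̄ → B̄^` with `c̄ ≫ λ_B̄ ≫ c̄^∨ = λ ≫ [p]`** —
the (r3₀-c) datum of `Roof₀` and the `(DBs, lamBs, hc3s)` input of ★ `RoofLegsSpecialFibreThroughBase.exists_roofLeg_specialFibre_of_downstairsDual` (r3₀-q).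
`--supports stmt-HodgeConjecture-24832`, count-neutral.  HONEST LABEL: HC_CM is proved only modulo the cell's 2 remaining named inputs (hLiu418 24832, h413 24833) until rung 0
closes; this file discharges none of them.

## Mathematics (the (ρ-𝔟) recipe, LA3-plan (g0) RULING #7 ∕ LA3-p01 (g0) 04:44Z design)

(B) ★ `exists_iso_sq_of_kernelLaw_idealTorsion_of_classEq`: `E : Q ≅ B̄` with the square `ι(a) ≫ q_K ≫ E = ι(b) ≫ c̄`, `(a)·𝔟 = (b)·𝔭`, `a, b ≠ 0`.  (NT) ★
`exists_conj_invariant_scalar_of_span_mul_eq`: `u ∈ 𝔟·c(𝔟)` with `u·(a·c a) = p·(b·c b)`.  (S-u) ★ `exists_twistHom_of_mem_mul_map'`: `ξ : Q → Q̂` with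
`q_K ≫ ξ ≫ q_K^∨ = λ ≫ ι(c u)^∨`.  Put `D_B̄ := D_Q.ofIso E` (★ `DualPair.ofIso`; unit pin ★ `nonempty_pullback_unitHatSlice_ofIso_iso`) and `λ_B̄ := E⁻¹ ≫ ξ`.  ★
`conj_comp_inv_comp_lam_comp_dualIsogenyOver_ofIso`: `ι(b) ≫ (c̄ ≫ λ_B̄ ≫ c̄^∨) ≫ ι(b)^∨ = ι(a) ≫ (λ ≫ ι(c u)^∨) ≫ ι(a)^∨`; by the Rosati rows and `ι(xy) = ι(y) ≫ ι(x)` the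
right side is `ι(u·c a·a) ≫ λ = ι(p·b·c b) ≫ λ = ι(b) ≫ (λ ≫ [p]) ≫ ι(b)^∨`; cancel the conjugation by `ι(b)` (★ `DualIsogenyConjCancel.eq_of_conj_dualIsogenyOver_eq`: `ι(b)` is
fppf with quasi-inverse `ι(b′)`, `b b′ ∈ ℕ_{>0}`, ★ `exists_nat_ne_zero_dvd`, ★ `flat_left_of_quasiInverse`).

## References
* [MumfordAV1970] D. Mumford, *Abelian Varieties* (1970), §7 Thm. 4 (p. 72), §15 Thm. 1 (p. 143), §23 Thm. 2 (p. 231).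
* [MilneCM2006] J. S. Milne, *Complex Multiplication* (2006), §7 (Def. 7.19, Prop. 7.22, Rem. 7.23, pp. 58–59).
* [Neukirch1999] J. Neukirch, *Algebraic Number Theory* (1999), Ch. I §3 (3.8)–(3.9).
* [Conrad2004GrossZagier] B. Conrad, *Gross–Zagier revisited*, MSRI Publ. 49 (2004), §7 (Thm. 7.5).
-/

set_option autoImplicit false

noncomputable section

set_option backward.isDefEq.respectTransparency false

open CategoryTheory CategoryTheory.Limits AlgebraicGeometry MonoidalCategory CartesianMonoidalCategory
open scoped MonObj CategoryTheory.Obj NumberField nonZeroDivisors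
open Literature.AlgebraicGeometry.Motives

namespace Literature.AlgebraicGeometry.AbelianSchemes

namespace AbelianSchemeOver

universe u

/-- A homomorphism commutes with multiplication by `m`: `[m]_M ≫ g = g ≫ [m]_N` (★ `mulN_comp_of_isMonHom`, restated to keep the import list short).
[cite: MumfordFogartyKirwan1994, Ch. 6 §1 Corollary 6.5 (p. 117)] -/
private theorem mulN_comp_of_isMonHom' {S : Scheme.{u}} {M N : AbelianSchemeOver S} (g : M.X ⟶ N.X) [IsMonHom g] (m : ℕ) :
    M.mulN m ≫ g = g ≫ N.mulN m := by
  rw [mulN_def, mulN_def, MonObj.pow_comp, MonObj.comp_pow, Category.id_comp, Category.comp_id]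

variable {Ω : Type u} [Field Ω] [IsAlgClosed Ω] {A Q B : AbelianSchemeOver (Spec (.of Ω))} [IsCommMonObj A.X]
  {F : Type*} [Field F] [NumberField F] (act : A.RingAction (𝓞 F)) (c : 𝓞 F ≃+* 𝓞 F)
  (D : A.DualPair) (hD : Nonempty ((Scheme.Modules.pullback (DualPair.unitHatSlice D)).obj D.P ≅ SheafOfModules.unit _))
  (lam : A.X ⟶ D.hat.X) [IsMonHom lam]
  (qK : A.X ⟶ Q.X) [IsMonHom qK] [Flat qK.left] [Surjective qK.left] [QuasiCompact qK.left]
  (DQ : Q.DualPair) (hDQ : Nonempty ((Scheme.Modules.pullback (DualPair.unitHatSlice DQ)).obj DQ.P ≅ SheafOfModules.unit _))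
  (cb : A.X ⟶ B.X) [IsMonHom cb] [Surjective cb.left]

include hD hDQ in
set_option maxHeartbeats 400000 in
/-- **THE DOWNSTAIRS DUAL OF THE ROOF MIDDLE** ((ρ-𝔟) assembled; see the module docstring).  Inputs: the involution `c` of `𝓞 F` (`hcc`), Rosati rows `hros` for `λ`, the
ideal-shape kernel laws of `q_K` (`𝔟`) and of `c̄` (`𝔭`) on all `T`-points, the class equation `↑𝔟 = x·↑𝔭` with `x ≠ 0` (the shape ★ `exists_idealClass_quotient_kernelLaw_dualPair`
delivers), and `𝔭·c(𝔭)·𝔡 = (p)` for a natural number `p`.  Output: `∃ (D_B̄ : B̄.DualPair) (unit pin) (λ_B̄ : B̄ → B̄^) (IsMonHom λ_B̄), c̄ ≫ λ_B̄ ≫ c̄^∨_{D, D_B̄} = λ ≫ [p]`.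
[cite: MumfordAV1970, §15 Thm. 1 (p. 143) and §23 Thm. 2 (p. 231)] [cite: MilneCM2006, §7 (Def. 7.19, Prop. 7.22, Rem. 7.23, pp. 58–59)] [cite: Neukirch1999, Ch. I §3 (3.8)–(3.9)] -/
theorem exists_dualPair_comp_lam_comp_dualIsogenyOver_eq_mulN_of_kernelLaws (hcc : ∀ y : 𝓞 F, c (c y) = y)
    (hros : ∀ b : 𝓞 F, haveI := act.isMonHom b; act.i (c b) ≫ lam = lam ≫ DualPair.dualIsogenyOver (act.i b) D D)
    {𝔟 𝔭 : Ideal (𝓞 F)} (h𝔟 : 𝔟 ≠ ⊥) (h𝔭 : 𝔭 ≠ ⊥)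
    (hkerK : ∀ ⦃T : Over (Spec (.of Ω))⦄ (t : T ⟶ A.X), t ≫ qK = 1 ↔ ∀ b ∈ 𝔟, t ≫ act.i b = 1)
    (hkerc : ∀ ⦃T : Over (Spec (.of Ω))⦄ (t : T ⟶ A.X), t ≫ cb = 1 ↔ ∀ a ∈ 𝔭, t ≫ act.i a = 1)
    {x : F} (hx0 : x ≠ 0) (hx : (𝔟 : FractionalIdeal (𝓞 F)⁰ F) = FractionalIdeal.spanSingleton (𝓞 F)⁰ x * (𝔭 : FractionalIdeal (𝓞 F)⁰ F))
    {p : ℕ} (𝔡 : Ideal (𝓞 F)) (hpd : 𝔭 * 𝔭.map (c : 𝓞 F →+* 𝓞 F) * 𝔡 = Ideal.span {(p : 𝓞 F)}) :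
    ∃ (DB : B.DualPair) (_ : Nonempty ((Scheme.Modules.pullback (DualPair.unitHatSlice DB)).obj DB.P ≅ SheafOfModules.unit _))
      (lamB : B.X ⟶ DB.hat.X) (_ : IsMonHom lamB),
      cb ≫ lamB ≫ DualPair.dualIsogenyOver cb D DB = lam ≫ D.hat.mulN p := by
  haveI : IsCommMonObj D.hat.X := D.hat.isCommMonObj_of_isReduced_base
  haveI : IsMonHom (D.hat.mulN p) := D.hat.isMonHom_mulN p
  -- (B) class invariance with its square, oriented `E : Q ≅ B̄`
  have hx' : (𝔭 : FractionalIdeal (𝓞 F)⁰ F) = FractionalIdeal.spanSingleton (𝓞 F)⁰ x⁻¹ * (𝔟 : FractionalIdeal (𝓞 F)⁰ F) := by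
    rw [hx, ← mul_assoc, FractionalIdeal.spanSingleton_mul_spanSingleton, inv_mul_cancel₀ hx0, FractionalIdeal.spanSingleton_one, one_mul]
  obtain ⟨a, b, E, ha, hb, -, hab, hEmon, hEinv, hsq⟩ :=
    exists_iso_sq_of_kernelLaw_idealTorsion_of_classEq act qK cb h𝔟 h𝔭 hkerK hkerc hx'
  haveI := hEmon
  haveI := hEinv
  -- (NT) the `c`-invariant scalar `u ∈ 𝔟·c(𝔟)` with `u·(a·c a) = p·(b·c b)`
  obtain ⟨u, hu, humem, hcu⟩ := Literature.NumberTheory.NumberFields.exists_conj_invariant_scalar_of_span_mul_eq c hcc ha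
    (map_natCast c p) hab hpd
  -- (S-u) the twist homomorphism `ξ : Q → Q̂` of `u`
  obtain ⟨ξ, hξ, hqξ⟩ := exists_twistHom_of_mem_mul_map' D DQ hD hDQ act (c : 𝓞 F →+* 𝓞 F) lam hros qK (fun T t ht => (hkerK t).mp ht) hcc humem
  haveI := hξ
  haveI := act.isMonHom a
  haveI := act.isMonHom b
  haveI := act.isMonHom (c u)
  -- the transported pair `D_B̄ := D_Q.ofIso E` with its unit pin, and `λ_B̄ := E⁻¹ ≫ ξ`
  have hDB := nonempty_pullback_unitHatSlice_ofIso_iso E DQ hDQ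
  haveI := DualPair.isMonHom_dualIsogenyOver cb D (DQ.ofIso E) hDB hD
  haveI := DualPair.isMonHom_dualIsogenyOver (act.i b) D D hD hD
  refine ⟨DQ.ofIso E, hDB, E.inv ≫ ξ, inferInstance, ?_⟩
  -- ★ transport: `ι(b) ≫ (c̄ ≫ λ_B̄ ≫ c̄^∨) ≫ ι(b)^∨ = ι(a) ≫ (λ ≫ ι(c u)^∨) ≫ ι(a)^∨`
  have hT := conj_comp_inv_comp_lam_comp_dualIsogenyOver_ofIso qK cb E (act.i a) (act.i b) hsq D DQ ξ lam
    (DualPair.dualIsogenyOver (act.i (c u)) D D) hqξ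
  -- the common value `ι(p·(b·c b)) ≫ λ`: right side by Rosati at `c u · a`
  have hR : act.i a ≫ (lam ≫ DualPair.dualIsogenyOver (act.i (c u)) D D) ≫ DualPair.dualIsogenyOver (act.i a) D D =
      act.i ((p : 𝓞 F) * (b * c b)) ≫ lam := by
    haveI := act.isMonHom (c u * a)
    rw [Category.assoc, ← DualPair.dualIsogenyOver_comp (act.i a) (act.i (c u)) D D D,
      DualPair.dualIsogenyOver_congr D D (ψ₂ := act.i (c u * a)) (h₂ := inferInstance) (act.i_mul (c u) a).symm, ← hros (c u * a),
      ← Category.assoc, ← act.i_mul, map_mul, hcc, ← hu, mul_assoc, mul_comm (c a) a]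
  -- … and left side `ι(b) ≫ (λ ≫ [p]) ≫ ι(b)^∨` by Rosati at `b` and `[p] = ι(p)`
  have hL : act.i b ≫ (lam ≫ D.hat.mulN p) ≫ DualPair.dualIsogenyOver (act.i b) D D = act.i ((p : 𝓞 F) * (b * c b)) ≫ lam := by
    rw [Category.assoc, mulN_comp_of_isMonHom' (DualPair.dualIsogenyOver (act.i b) D D) p, ← Category.assoc lam, ← hros b,
      Category.assoc, ← mulN_comp_of_isMonHom' lam p, mulN_def, ← act.i_natCast, ← Category.assoc, ← act.i_mul, ← Category.assoc, ← act.i_mul,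
      mul_comm (c b) b]
  -- cancel the conjugation by `ι(b)` (fppf, quasi-inverse `ι(b′)` with `b b′ = n ∈ ℕ_{>0}`)
  obtain ⟨n, hn, b', hbb'⟩ := Literature.Algebra.Module.DivisibleActionSurjective.exists_nat_ne_zero_dvd b hb
  haveI := act.isMonHom b'
  have h1 : act.i b ≫ act.i b' = (𝟙 A.X : A.X ⟶ A.X) ^ n := by rw [← act.i_mul, mul_comm, ← hbb', act.i_natCast]
  have h2 : act.i b' ≫ act.i b = (𝟙 A.X : A.X ⟶ A.X) ^ n := by rw [← act.i_mul, ← hbb', act.i_natCast]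
  haveI : Flat (act.i b).left := flat_left_of_quasiInverse (act.i b) (act.i b') hn h1 h2
  haveI : Surjective (act.i b).left := surjective_left_of_quasiInverse (act.i b) (act.i b') hn h1 h2
  haveI : IsFinite (act.i b).left := isFinite_left_of_quasiInverse (act.i b) (act.i b') hn h1 h2
  haveI : QuasiCompact (act.i b).left := inferInstance
  exact eq_of_conj_dualIsogenyOver_eq (act.i b) (act.i b') hn h2 D D hD _ _ (hT.trans (hR.trans hL.symm))


include hD hDQ in
omit [Flat qK.left] [Surjective qK.left] [QuasiCompact qK.left] in
/-- **(ED. 2) The same, with `q_K`'s fppf properties as EXPLICIT hypotheses and `q_K` implicit** (read off `hkerK`): a Lines-side consumer whose `q_K` is the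
`show …quotientBy… from A.quotientMk (𝟙 _) K _` term of ★ `exists_idealClass_quotient_kernelLaw_dualPair` passes ★ `flat_quotientMk_left`, ★ `surjective_quotientMk_left`,
★ `isAffineHom_quotientMk_left` (⇒ quasi-compact) as terms without re-spelling `q_K`. [cite: MumfordAV1970, §7 Thm. 4 (p. 72) and §23 Thm. 2 (p. 231)] -/
theorem exists_dualPair_comp_lam_comp_dualIsogenyOver_eq_mulN_of_kernelLaws' (hcc : ∀ y : 𝓞 F, c (c y) = y)
    (hros : ∀ b : 𝓞 F, haveI := act.isMonHom b; act.i (c b) ≫ lam = lam ≫ DualPair.dualIsogenyOver (act.i b) D D)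
    {𝔟 𝔭 : Ideal (𝓞 F)} (h𝔟 : 𝔟 ≠ ⊥) (h𝔭 : 𝔭 ≠ ⊥)
    (hkerK : ∀ ⦃T : Over (Spec (.of Ω))⦄ (t : T ⟶ A.X), t ≫ qK = 1 ↔ ∀ b ∈ 𝔟, t ≫ act.i b = 1)
    (hflat : Flat qK.left) (hsurj : Surjective qK.left) (hqc : QuasiCompact qK.left)
    (hkerc : ∀ ⦃T : Over (Spec (.of Ω))⦄ (t : T ⟶ A.X), t ≫ cb = 1 ↔ ∀ a ∈ 𝔭, t ≫ act.i a = 1)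
    {x : F} (hx0 : x ≠ 0) (hx : (𝔟 : FractionalIdeal (𝓞 F)⁰ F) = FractionalIdeal.spanSingleton (𝓞 F)⁰ x * (𝔭 : FractionalIdeal (𝓞 F)⁰ F))
    {p : ℕ} (𝔡 : Ideal (𝓞 F)) (hpd : 𝔭 * 𝔭.map (c : 𝓞 F →+* 𝓞 F) * 𝔡 = Ideal.span {(p : 𝓞 F)}) :
    ∃ (DB : B.DualPair) (_ : Nonempty ((Scheme.Modules.pullback (DualPair.unitHatSlice DB)).obj DB.P ≅ SheafOfModules.unit _))
      (lamB : B.X ⟶ DB.hat.X) (_ : IsMonHom lamB),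
      cb ≫ lamB ≫ DualPair.dualIsogenyOver cb D DB = lam ≫ D.hat.mulN p :=
  haveI := hflat; haveI := hsurj; haveI := hqc
  exists_dualPair_comp_lam_comp_dualIsogenyOver_eq_mulN_of_kernelLaws act c D hD lam qK DQ hDQ cb hcc hros h𝔟 h𝔭 hkerK hkerc hx0 hx 𝔡 hpd

end AbelianSchemeOver

end Literature.AlgebraicGeometry.AbelianSchemes

end
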